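import Mathlib

/-!
# B3 BLOCK-TRACE for box (semihomogeneous) letters — count tables and the algebra of the proof deltas (hsemireg-monad-4 g16)

Companion to memo `Cruxes/BlochSeedDiscOne/B3-BLOCKTRACE-SH-monad4-g16.md` (THEOREM BLOCK-TRACE-SH): the BLOCK-TRACE(-TW)
count law `dim ⋂ₖ ker σₖ(L) ≥ β := Σ_f [(m − t)(m − σ_f) − 1]₊` for a letter complex `A → N → C` on `X = (E_i × E_i)^4` whose
letters are EXTERIOR PRODUCTS OF VECTOR-BUNDLE BOXES (program-M semihomogeneous alphabet included), `m` = number of COPIES of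
the block letter `Z`.  The memo's deltas over the line-bundle proof: (2.1′) a feeder `x` gets factor-`f` credit (its columns
enter `S_f`) iff the cup map `∪η_f : H⁰(S_f, Hom(x_f,Z_f)) → H²(S_f, Hom(x_f,Z_f))` is non-zero — on the program-M alphabet iff
the factor pair is EQ-live; (2.2′) project `End(Z^m) = End Z ⊗ gl(m)` to `𝒪 ⊗ gl(m)` by the normalized trace; (2.3′) the trace
identity `Tr((η ⊗ 1_Z ⊗ M)·(F_Z ⊗ 1)^k) = η·Tr(F_Z^k)·tr M` — no central-curvature hypothesis.

This file checks ONLY finite tables and finite-dimensional algebra (no geometry, no sheaf, no design verdict):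
* §1 `FacRow`, `triple`, `creditF`, `liveF` — the program-M per-factor `(h⁰,h¹,h²)` law of semihom-1 g29 §9 as a table
  (EQ `(1,2,1)` ∕ `(0,0,0)` by the bit rule, RAY `(D,D,0)` ∕ `(0,D,D)`, CROSS `(0,n,0)`), the CREDIT predicate
  (`h⁰ > 0 ∧ h² > 0` ⟺ EQ-live: `creditF_iff`, Boolean tables), `ray_cross_no_credit`, `eq_dichotomy` (TWIST-MONOTONE-SH shadow: every
  Pic⁰-twist of an EQ row is again `(1,2,1)` or `(0,0,0)`); `kunneth` = coefficient list of `Π_f (h⁰_f + h¹_f t + h²_f t²)`,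
  rows `kunneth_eq4` (= `H^•(X,𝒪)`: 1 8 28 56 70 56 28 8 1), the VISIBILITY pattern for M-feeders (`visibleM_iff`: visible iff
  RAY on ≤ 2 factors), `feederM_iff` (feeder iff no CROSS ∕ reversed-RAY ∕ bit-killed factor).
* §2 the B96 rows (check-static-1 BATCH 96 ∕ check-class-1 BATCH 154, M1 = a24-dblC3): the four `m = 3` N36 middle blocks,
  `τ = 0`, `τ_f = 4` on every factor ⇒ `σ_f = min 3 4 = 3` ⇒ `β = 0` (SILENT, `n36_level_silent`), margin one
  (`n36_margin_one`: `σ_f = 2` on one factor gives `2`), the no-credit hypothetical `32` (`n36_noCredit`), and the generic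
  per-copy room `β^tw = 4·(3 − 1) = 8` (`n36_genericRoom`).
* §3 `trace_eta_kronecker_pow` — the algebra of 2.3′: `trace ((η • (1 ⊗ₖ M)) * (A ⊗ₖ 1)^k) = η * trace (A^k) * trace M`
  for matrices over any commutative ring (the even-form algebra), i.e. `σ_k(ξ_{f,M}) = (η_f ∧ Tr F_Z^k)·tr M` with NO
  assumption that `F_Z` is central.
* §4 the algebra of LEMMA SPLIT-OFF′ (memo g15 v1.1 §2.7′): (a) `finrank_ker_blockSum` — the kernel of
  `(η_u)_{u<n} ↦ Σ_u η_u` on `(Fin n → V)` has dimension `(n − 1)·dim V` (`= 28 (n − 1)` for `V = H^{0,2}(X)`, `X` the abelian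
  8-fold); (b) `trace_offDiag_mul_diag_pow` — `trace (ξ · At^k) = 0` for `ξ` block-off-diagonal and `At` block-diagonal.
Mathlib only; no `sorry`, no new axioms, no `instance`, no notation introduced (Mathlib's scoped `⊗ₖ` is opened, not
declared), no unsafe options.  Designs ≠ displays ≠ sheaves ≠ SEED; nothing here is proved toward HC ∕ HC_AV ∕ 18881 ∕ H2.
-/

namespace Summit.HodgeConjecture.HodgeConjecture.Cruxes.BlochSeedDiscOne.BlockTraceSH

/-! ## §1 The program-M per-factor table (semihom-1 g29 §9) and the credit predicate -/

/-- One factor of an ordered pair of program-M letters `s → t` (the bundle is `Hom(E_s, E_t)` on `S = E_i × E_i`):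
`eq l b` — same letter, box rank `l`, relative bit `b`; `rayUp D` ∕ `rayDown D` — same ray or apex-involved with
`D = C_s l_t − C_t l_s` positive ∕ negative of absolute value `D ≥ 1`; `cross n` — charged on different rays,
`n = 2 C_s C_t (1 − Re(u_t ū_s))`. -/
inductive FacRow
  | eq (l : ℕ) (b : Bool)
  | rayUp (D : ℕ)
  | rayDown (D : ℕ)
  | cross (n : ℕ)

open FacRow

/-- `(h⁰, h¹, h²)` of the factor bundle (semihom §9 LAW: EQ `(1,2,1)` if `b = 0` or `2 ∣ l`, else `(0,0,0)`;
RAY `(D,D,0)` ∕ `(0,D,D)`; CROSS `(0,n,0)`). -/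
def triple : FacRow → ℕ × ℕ × ℕ
  | eq l b => if b = false ∨ l % 2 = 0 then (1, 2, 1) else (0, 0, 0)
  | rayUp D => (D, D, 0)
  | rayDown D => (0, D, D)
  | cross n => (0, n, 0)

/-- `h⁰` of the factor bundle. -/
def h0 (r : FacRow) : ℕ := (triple r).1
/-- `h¹` of the factor bundle. -/
def h1 (r : FacRow) : ℕ := (triple r).2.1
/-- `h²` of the factor bundle. -/
def h2 (r : FacRow) : ℕ := (triple r).2.2

/-- the factor contributes sections (`h⁰ > 0`), as a Boolean table entry. -/
def liveF (r : FacRow) : Bool := decide (0 < h0 r)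

/-- CREDIT on this factor (memo 2.1′): the cup `∪η_f : H⁰ → H²` of the factor bundle is non-zero.  On the program-M
alphabet `H⁰` and `H²` both sit on the trivial summand `𝒪_S` of `q_u^*(End F ⊗ η₀^b)` when it is present, and
`∪η_f : H⁰(S,𝒪) → H²(S,𝒪)` is an isomorphism, so credit ⟺ `h⁰ > 0 ∧ h² > 0`. -/
def creditF (r : FacRow) : Bool := decide (0 < h0 r ∧ 0 < h2 r)

/-- EQ-live: same letter and (bit `0` or even box rank). -/
def eqLive : FacRow → Bool
  | eq l b => (!b) || (l % 2 == 0)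
  | _ => false

/-- CREDIT ⟺ EQ-live (the check seats' transcription «credit when the feeder's box is isomorphic to the block's on `f`,
rank-2 boxes bit-blind» is exactly the theorem's clause). -/
theorem creditF_iff (r : FacRow) : creditF r = eqLive r := by
  cases r with
  | eq l b =>
    cases b <;> rcases Nat.mod_two_eq_zero_or_one l with h | h <;> simp [creditF, eqLive, h0, h2, triple, h]
  | rayUp D => simp [creditF, eqLive, h0, h2, triple]
  | rayDown D => simp [creditF, eqLive, h0, h2, triple]
  | cross n => simp [creditF, eqLive, h0, h2, triple]

/-- RAY and CROSS factors never give credit (RAY up: `h² = 0`, correctable; RAY down ∕ CROSS: `h⁰ = 0`). -/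
theorem ray_cross_no_credit (D n : ℕ) :
    creditF (rayUp D) = false ∧ creditF (rayDown D) = false ∧ creditF (cross n) = false := by
  refine ⟨?_, ?_, ?_⟩ <;> simp [creditF, h0, h2, triple]

/-- TWIST-MONOTONE-SH shadow for EQ rows: the triple is `(1,2,1)` or `(0,0,0)` — and a Pic⁰-twist of an EQ pair is again an
EQ-type bundle `q_u^*(⊕_ξ P_ξ) ⊗ P`, alive exactly on a finite set of twists, so the same dichotomy holds in every room
(NB the bit-killed row `eq l true`, `l` odd, is REVIVED by the torsion twist `η` on that factor). -/
theorem eq_dichotomy (l : ℕ) (b : Bool) : triple (eq l b) = (1, 2, 1) ∨ triple (eq l b) = (0, 0, 0) := by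
  by_cases h : (b = false ∨ l % 2 = 0)
  · left; simp [triple, h]
  · right; simp [triple, h]

/-- the M1 half letters (`l = 2`) are bit-blind; the unit∕apex letters (`l = 1`) die under an odd relative bit. -/
theorem eq_rows_M1 : triple (eq 2 true) = (1, 2, 1) ∧ triple (eq 2 false) = (1, 2, 1) ∧
    triple (eq 1 false) = (1, 2, 1) ∧ triple (eq 1 true) = (0, 0, 0) := by decide

/-- reversed pair (`Hom(E_t, E_s)`): EQ and CROSS symmetric, RAY up ↔ down (Serre on the factor: `h^j ↔ h^{2−j}`). -/
def rev : FacRow → FacRow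
  | eq l b => eq l b
  | rayUp D => rayDown D
  | rayDown D => rayUp D
  | cross n => cross n

theorem rev_serre (r : FacRow) : h0 (rev r) = h2 r ∧ h1 (rev r) = h1 r ∧ h2 (rev r) = h0 r := by
  cases r with
  | eq l b =>
    by_cases h : (b = false ∨ l % 2 = 0) <;> simp [rev, h0, h1, h2, triple, h]
  | rayUp D => simp [rev, h0, h1, h2, triple]
  | rayDown D => simp [rev, h0, h1, h2, triple]
  | cross n => simp [rev, h0, h1, h2, triple]

/-! ### Künneth on `X = S⁴`: `h^k(Hom) = Σ_{|j| = k} Π_f h^{j_f}_f` = coefficient list of `Π_f (h⁰_f + h¹_f t + h²_f t²)` -/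

/-- coefficient `k` of the product of two coefficient lists. -/
def convCoeff (a b : List ℕ) (k : ℕ) : ℕ :=
  ((List.range (k + 1)).map fun i => a.getD i 0 * b.getD (k - i) 0).sum

/-- product of two coefficient lists. -/
def polyMul (a b : List ℕ) : List ℕ :=
  (List.range (a.length + b.length - 1)).map (convCoeff a b)

/-- `[h⁰, h¹, …, h^{2·#factors}]` of `Hom` between two exterior products, from the factor rows. -/
def kunneth (rows : List FacRow) : List ℕ :=
  rows.foldr (fun r acc => polyMul [h0 r, h1 r, h2 r] acc) [1]

/-- `h^k` on `X`. -/
def hX (rows : List FacRow) (k : ℕ) : ℕ := (kunneth rows).getD k 0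

/-- sanity: four EQ-live factors give `H^•(X, 𝒪_X)` of the abelian 8-fold, `C(8,k)`: `h¹ = 8`, `h² = 28`. -/
theorem kunneth_eq4 : kunneth [eq 1 false, eq 2 true, eq 2 false, eq 1 false] = [1, 8, 28, 56, 70, 56, 28, 8, 1] := by
  decide

/-- sanity: the ORPHAN-PAIR shape (two EQ-live common factors, two reversed unit RAY steps) has `h² = 1·1·1·1·… `:
`(1+2t+t²)²·(t+t²)²` has `t²`-coefficient `1`; with `D = 4` on both RAY factors it is `16`. -/
theorem kunneth_orphan_shape : hX [eq 2 false, eq 2 false, rayDown 1, rayDown 1] 2 = 1 ∧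
    hX [eq 2 false, eq 2 false, rayDown 4, rayDown 4] 2 = 16 := by decide

/-- a summand `x` is a FEEDER of the block letter `Z` iff `h⁰(X, Hom(x,Z)) > 0` iff every factor is live
(EQ-live or RAY up); one CROSS, reversed-RAY or bit-killed factor kills the block.  Finite check over the
representative rows (positivity pattern only; `D, n ≥ 1`). -/
def repRows : List FacRow := [eq 1 false, eq 1 true, eq 2 true, rayUp 1, rayDown 1, cross 2]

theorem feederM_iff : ∀ a ∈ repRows, ∀ b ∈ repRows, ∀ c ∈ repRows, ∀ d ∈ repRows,
    (0 < hX [a, b, c, d] 0 ↔ (liveF a && liveF b && liveF c && liveF d) = true) := by decide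

/-- VISIBILITY LAW for M-feeders (memo 2.2′: `x` visible iff `H²(X, Hom(Z, x)) ≠ 0`, the REVERSED rows): a feeder all of
whose factors are EQ-live or RAY-up is visible iff it is RAY on at most two factors — the LINE law «differs from `Z` on
≤ 2 factors» verbatim.  Finite check on the pattern `p : Fin 4 → Bool` (`true` = RAY factor, representative `D = 1`;
`false` = EQ-live); for `D ≥ 1` only the positive values scale. -/
def patRow (ray : Bool) : FacRow := if ray then rayUp 1 else eq 2 false

/-- number of RAY factors of a pattern. -/
def rayCount (a b c d : Bool) : ℕ := (if a then 1 else 0) + (if b then 1 else 0) + (if c then 1 else 0) + (if d then 1 else 0)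

theorem visibleM_iff (a b c d : Bool) :
    0 < hX [rev (patRow a), rev (patRow b), rev (patRow c), rev (patRow d)] 2 ↔ rayCount a b c d ≤ 2 := by
  revert a b c d; decide

/-! ## §2 The B96 rows: the four `m = 3` N36 middle blocks of M1 = a24-dblC3 -/

/-- per-factor count of THEOREM BLOCK-TRACE(-SH): `(m − σ_f)(m − t) − 1` (ℕ-subtraction = positive part). -/
def betaF (m t σ : ℕ) : ℕ := (m - σ) * (m - t) - 1

/-- `β(Z) = Σ_f [(m − σ_f)(m − t) − 1]₊` over the four factors. -/
def beta (m t : ℕ) (σs : List ℕ) : ℕ := (σs.map (betaF m t)).sum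

/-- letter-level evaluation: `σ_f = min m τ_f` (the `τ_f` credited columns are generic), `t = min m τ`. -/
def betaLetter (m τ : ℕ) (τf : List ℕ) : ℕ := beta m (min m τ) (τf.map (min m))

/-- B96∕B154 row: `m = 3`, `τ = 0` (32 A-feeders, none fed-able or visible), `τ_f = (4,4,4,4)` (orphan A-feeders EQ-live with
the block on each factor — CREDITED, §1) ⇒ `β = 0`: B3-SILENT at class level. -/
theorem n36_level_silent : betaLetter 3 0 [4, 4, 4, 4] = 0 := by decide

/-- the margin is ONE: were the credited columns confined to a plane on one factor (`σ_f = 2`), that factor alone gives `2`. -/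
theorem n36_margin_one : betaF 3 0 2 = 2 ∧ beta 3 0 [2, 3, 3, 3] = 2 := by decide

/-- check-static-1's hypothetical «no per-factor credit for boxes» (`τ_f = 0`, φ = 4) would have given `8` per factor, `32`. -/
theorem n36_noCredit : betaLetter 3 0 [0, 0, 0, 0] = 32 := by decide

/-- one twist class of copies (memo g15 THEOREM BLOCK-TRACE-TW): multiplicity `m`, hit dimension `t`, killed dimension `s`. -/
structure ClassData where
  m : ℕ
  t : ℕ
  s : ℕ

/-- `β^tw_f = [Σ_j (m_j − σ_{f,j})(m_j − t_j) − 1]₊`. -/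
def betaTwF (cs : List ClassData) : ℕ := (cs.map fun c => (c.m - c.s) * (c.m - c.t)).sum - 1

/-- ROOM READING (informational): a room splitting the three copies by generic independent twists kills every feeder and all
credit (EQ → `(0,0,0)` off a finite twist set, RAY → `(0,0,0)` off `q_u^* Pic⁰(E_u)`): three classes `(1,0,0)` per factor ⇒
`β^tw = 4·(3 − 1) = 8` per block — such a room is B3-dead; the level room is silent (`n36_level_silent`). -/
theorem n36_genericRoom : betaTwF [⟨1, 0, 0⟩, ⟨1, 0, 0⟩, ⟨1, 0, 0⟩] = 2 ∧
    4 * betaTwF [⟨1, 0, 0⟩, ⟨1, 0, 0⟩, ⟨1, 0, 0⟩] = 8 := by decide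

/-- the unsplit class `(3, 0, 3)` reproduces the level count `0` per factor (consistency of §2 with BLOCK-TRACE-TW). -/
theorem n36_level_as_tw : betaTwF [⟨3, 0, 3⟩] = 0 ∧ betaTwF [⟨3, 0, 0⟩] = 8 := by decide

/-! ## §3 The trace identity of step 2.3′ (no central curvature needed)
Matrices over a commutative ring `R` (the algebra of even-degree forms at a point, or formal): `A` = the curvature `F_Z` of ONE
copy of the box letter (`n × n`, NOT assumed central), `M ∈ gl(m)` acting on the copies, `η` = the scalar 2-form `η_f`.
On `Z^m = Z ⊗ ℂ^m` the cocycle is `η • (1 ⊗ M)` and `α₀^k = (F_Z ⊗ 1)^k`; the supertrace word of internal degree 0 is their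
product, whose trace FACTORS: `η · Tr(F_Z^k) · tr M`.  Hence `σ_k(ξ_{f,M}) = c_{k,f} · tr M` with `c_{k,f}` independent of `M`,
and `tr M = 0` puts `ξ_{f,M}` in `⋂ₖ ker σₖ`. -/

section TraceIdentity

open scoped Kronecker

variable {R : Type*} [CommRing R] {n m : Type*} [Fintype n] [Fintype m] [DecidableEq n] [DecidableEq m]

theorem kronecker_one_pow (A : Matrix n n R) (k : ℕ) :
    (A ⊗ₖ (1 : Matrix m m R)) ^ k = (A ^ k) ⊗ₖ (1 : Matrix m m R) := by
  induction k with
  | zero => simp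
  | succ k ih => rw [pow_succ, ih, ← Matrix.mul_kronecker_mul, one_mul, ← pow_succ]

/-- `Tr((η ⊗ 1_Z ⊗ M) · (F_Z ⊗ 1)^k) = η · Tr(F_Z^k) · tr M`. -/
theorem trace_eta_kronecker_pow (A : Matrix n n R) (M : Matrix m m R) (η : R) (k : ℕ) :
    Matrix.trace ((η • ((1 : Matrix n n R) ⊗ₖ M)) * (A ⊗ₖ (1 : Matrix m m R)) ^ k)
      = η * Matrix.trace (A ^ k) * Matrix.trace M := by
  rw [kronecker_one_pow, Matrix.smul_mul, ← Matrix.mul_kronecker_mul, one_mul, mul_one, Matrix.trace_smul,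
    Matrix.trace_kronecker, smul_eq_mul, mul_assoc]

/-- consequence used in 2.3′: `tr M = 0` ⇒ every `σ_k` vanishes on the cocycle. -/
theorem trace_eta_kronecker_pow_eq_zero (A : Matrix n n R) (M : Matrix m m R) (η : R) (k : ℕ)
    (hM : Matrix.trace M = 0) :
    Matrix.trace ((η • ((1 : Matrix n n R) ⊗ₖ M)) * (A ⊗ₖ (1 : Matrix m m R)) ^ k) = 0 := by
  rw [trace_eta_kronecker_pow, hM, mul_zero]

end TraceIdentity

/-! ## §4 The algebra of LEMMA SPLIT-OFF′ (memo g15 v1.1 §2.7′)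
(a) `n` isolated summands `y_u` with EQUAL `c₁ = c`: on the diagonal classes `(η_u ⊗ 1_{y_u})_u ∈ ⊕_u Ext²(y_u,y_u)`,
`σ_k = (1/k!)(Σ_u η_u) ∪ c^k`, so `{(η_u) : Σ_u η_u = 0}` is σ-blind; its dimension is `(n − 1)·h^{0,2}(X) = 28 (n − 1)`.
(b) two isolated summands `y, y′`: `At(L)` is block-diagonal and a class in the off-diagonal block `Ext²(y,y′)` has
`Tr(ξ ∘ At^k) = 0` for every `k`, so the whole block is σ-blind. -/

section SplitOffPrime

variable (K V : Type*) [Field K] [AddCommGroup V] [Module K V]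

/-- `(η_u)_{u < n} ↦ Σ_u η_u`. -/
def blockSum (n : ℕ) : (Fin n → V) →ₗ[K] V := ∑ u : Fin n, LinearMap.proj u

variable {K V}

theorem blockSum_apply (n : ℕ) (η : Fin n → V) : blockSum K V n η = ∑ u : Fin n, η u := by
  simp [blockSum, LinearMap.sum_apply]

theorem blockSum_surjective (n : ℕ) (hn : 1 ≤ n) : Function.Surjective (blockSum K V n) := by
  intro v
  refine ⟨Pi.single (⟨0, hn⟩ : Fin n) v, ?_⟩
  rw [blockSum_apply, Finset.sum_pi_single']
  simp

/-- LEMMA SPLIT-OFF′ (a), linear algebra: `dim {(η_u)_{u<n} : Σ_u η_u = 0} = (n − 1) · dim V`. -/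
theorem finrank_ker_blockSum [FiniteDimensional K V] (n : ℕ) (hn : 1 ≤ n) :
    Module.finrank K (LinearMap.ker (blockSum K V n)) = (n - 1) * Module.finrank K V := by
  have h := LinearMap.finrank_range_add_finrank_ker (blockSum K V n)
  rw [LinearMap.range_eq_top.mpr (blockSum_surjective n hn), finrank_top, Module.finrank_pi_fintype,
    Finset.sum_const, Finset.card_univ, Fintype.card_fin, smul_eq_mul] at h
  rw [Nat.sub_mul, one_mul]
  generalize n * Module.finrank K V = X at h ⊢
  omega

/-- with `dim V = h^{0,2}(X) = 28` (abelian 8-fold) and `n = 2, 3, 16`: `28, 56, 420` σ-blind classes. -/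
theorem finrank_ker_blockSum_rows [FiniteDimensional K V] (hV : Module.finrank K V = 28) :
    Module.finrank K (LinearMap.ker (blockSum K V 2)) = 28 ∧
    Module.finrank K (LinearMap.ker (blockSum K V 3)) = 56 ∧
    Module.finrank K (LinearMap.ker (blockSum K V 16)) = 420 := by
  refine ⟨?_, ?_, ?_⟩ <;> rw [finrank_ker_blockSum _ (by norm_num), hV]

end SplitOffPrime

section OffDiagonal

variable {R : Type*} [CommRing R] {p q : Type*} [Fintype p] [Fintype q] [DecidableEq p] [DecidableEq q]

omit [DecidableEq p] [DecidableEq q] in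
theorem trace_fromBlocks' (A : Matrix p p R) (B : Matrix p q R) (C : Matrix q p R) (D : Matrix q q R) :
    (Matrix.fromBlocks A B C D).trace = A.trace + D.trace := by
  simp [Matrix.trace, Fintype.sum_sum_type]

/-- LEMMA SPLIT-OFF′ (b), linear algebra: for `ξ = (0 B; C 0)` block-off-diagonal and `At = (A₁ 0; 0 A₂)` block-diagonal,
`Tr(ξ · At^k) = 0` for every `k` (an off-diagonal word has no diagonal blocks). -/
theorem trace_offDiag_mul_diag_pow (B : Matrix p q R) (C : Matrix q p R) (A₁ : Matrix p p R) (A₂ : Matrix q q R) (k : ℕ) :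
    (Matrix.fromBlocks 0 B C 0 * (Matrix.fromBlocks A₁ 0 0 A₂) ^ k).trace = 0 := by
  rw [Matrix.fromBlocks_diagonal_pow, Matrix.fromBlocks_multiply]
  simp [trace_fromBlocks']

end OffDiagonal

end Summit.HodgeConjecture.HodgeConjecture.Cruxes.BlochSeedDiscOne.BlockTraceSH
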